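import Mathlib
import HarnessLib
import Literature.Analysis.FluidPDE.SelfSimilar
import Summits.NavierStokesRegularity.NavierStokesRegularity.Theorems.PoloidalWindowDoorPoloidalWindowRigidityEternalCoreParaboloidGap
import Summits.NavierStokesRegularity.NavierStokesRegularity.Theorems.PoloidalWindowDoorPoloidalWindowRigidityWindow
import Summits.NavierStokesRegularity.NavierStokesRegularity.Theorems.PoloidalWindowDoorPoloidalWindowRigidityPoloidalExtremal

/-!
# Route `PoloidalWindowDoor`, item `LrcModEntire` (stmt-NavierStokesRegularity-20428), cell (Q4-curved), v17 child «FLAT SCALING LIMIT» (X_H) —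
# ENTRANCE BRICKS FOR THE CLOSER (H2 eternal core from the hot value, H3 limit identification, H5 the (TH) bilinear identity under rescaling and limits)

Cell ns-regularity-ideate, helper seat ns-k2-port-2 g9 under the LEAD of item 20428 (ns-poloidal-K2-p3 g18, P6 2026-08-30T02:55:17Z / 03:05:26Z); consumer =
K2-p2 g18's `…Q4CurvedFlatLimit.false_of_flatScalingLimit` (H3–H8); `--supports stmt-NavierStokesRegularity-20428 --as helper`.

* ★★ `eternalCore_of_hotValue` (H2) — a Type-I ancient mild profile with a non-zero hot value `U₂(−1,0) ≠ 0` has an ETERNAL CORE at the origin, in the exact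
  hypothesis shape of `…EternalCoreScalingRecurrentCore.scalingRecurrentCore`: `∃ ε₀ R₀ > 0, ∀ t₀ < −1, ∃ r ∈ [4t₀, t₀], ∃ y, ‖y‖ ≤ R₀√(−r) ∧ ε₀ ≤ √(−r)‖U r y‖`
  (contrapositive of the PARABOLOID GAP `…EternalCoreParaboloidGap.paraboloidGap` at `(s, x) = (−1, 0)` with `ε := min ε₁ (|U₂(−1,0)|/3)`);
  `eternalCore_of_hotValue_class` = the same from the class quadruple.
* ★ `bilinearTH_nsRescale` (H5a; via `…PoloidalExtremal.fderiv_nsRescale_slice`) — the (TH) bilinear identity `∂_zU_b(x)·∂_cU₂(x′) = ∂_zU_c(x′)·∂_bU₂(x)` (`x₂ = x′₂`, `b, c ≠ 2`) is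
  invariant under the parabolic rescaling `nsRescale λ` (`λ > 0`; every first derivative scales by `λ²`).
* ★ `bilinearTH_of_tendsto_fderiv` (H5b) — the identity passes to limits under pointwise convergence of `fderiv` (the conjunct exported by
  `…SqueezeCycleExtremalElementExistsExtraction.exists_tendsto_of_isTypeIAncientMild_seq`).
* `eq_of_tendstoLocallyUniformly_subseq` (H3) — a pointwise limit along a subsequence of a locally uniformly convergent sequence is the locally uniform limit.

WHAT THIS IS NOT: not a claim about Navier–Stokes regularity; closes nothing (entrance bricks for the v17 FlatLimit child; the CurvedLimits child stays research);
items 20428 / 19708 / 27893 OPEN (bears_on LADDER-NS N0).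
-/

noncomputable section

set_option linter.dupNamespace false
set_option linter.style.longLine false

namespace Summit.NavierStokesRegularity.NavierStokesRegularity.Theorems.PoloidalWindowDoorLrcModEntireQ4CurvedFlatLimitEntrance

open Set Function Filter Topology Metric
open scoped RealInnerProductSpace InnerProductSpace
open Literature.Analysis Literature.Analysis.FluidPDE Literature.Analysis.UnboundedOperators
open Summit.NavierStokesRegularity.NavierStokesRegularity.Theorems
open Summit.NavierStokesRegularity.NavierStokesRegularity.Theorems.PoloidalWindowDoorPoloidalWindowRigidityEternalCoreParaboloidGap
open Summit.NavierStokesRegularity.NavierStokesRegularity.Theorems.PoloidalWindowDoorPoloidalWindowRigidityWindow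
open Summit.NavierStokesRegularity.NavierStokesRegularity.Theorems.PoloidalWindowDoorPoloidalWindowRigidityPoloidalExtremal

/-! ### H2: the eternal core from the hot value -/

/-- ★★ **H2 — A NON-ZERO HOT VALUE GIVES AN ETERNAL CORE AT THE ORIGIN** (paraboloid-gap contrapositive), in the hypothesis shape of
`…EternalCoreScalingRecurrentCore.scalingRecurrentCore`. -/
theorem eternalCore_of_hotValue {C : ℝ} {U : ℝ → EuclideanSpace ℝ (Fin 3) → EuclideanSpace ℝ (Fin 3)}
    (hA : IsTypeIAncientMild C U) (hne : U (-1) 0 2 ≠ 0) :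
    ∃ ε₀ R₀ : ℝ, 0 < ε₀ ∧ 0 < R₀ ∧ ∀ t₀ : ℝ, t₀ < (-1) → ∃ r ∈ Set.Icc (4 * t₀) t₀, ∃ y : EuclideanSpace ℝ (Fin 3),
      ‖y‖ ≤ R₀ * Real.sqrt (-r) ∧ ε₀ ≤ Real.sqrt (-r) * ‖U r y‖ := by
  obtain ⟨ε₁, hε₁, hgap⟩ := paraboloidGap C
  set M : ℝ := |U (-1) 0 2| with hM
  have hM0 : 0 < M := abs_pos.2 hne
  set ε : ℝ := min ε₁ (M / 3) with hε
  have hεpos : 0 < ε := lt_min hε₁ (by positivity)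
  have hεle : ε ≤ ε₁ := min_le_left _ _
  have hεM : ε ≤ M / 3 := min_le_right _ _
  obtain ⟨R₁, hR₁, hR⟩ := hgap ε hεpos hεle
  refine ⟨ε, R₁, hεpos, hR₁, fun t₀ ht₀ => ?_⟩
  by_contra hno
  push Not at hno
  -- smallness on the window `[4t₀, t₀]`
  have hsmall : ∀ r ∈ Set.Icc (4 * t₀) t₀, ∀ y : EuclideanSpace ℝ (Fin 3), ‖y‖ ≤ R₁ * Real.sqrt (-r) → Real.sqrt (-r) * ‖U r y‖ ≤ ε :=
    fun r hr y hy => (hno r hr y hy).le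
  -- the gap propagates to `(s, x) = (−1, 0)`
  have h := hR R₁ le_rfl U hA t₀ (by linarith) hsmall (-1) ht₀.le (by norm_num) 0 (by simp; positivity)
  have h1 : ‖U (-1) 0‖ ≤ 2 * ε := by simpa using h
  -- but `|U₂(−1,0)| ≤ ‖U(−1,0)‖`
  have h2 : M ≤ ‖U (-1) 0‖ := by
    have hi : ⟪U (-1) 0, (EuclideanSpace.single 2 (1 : ℝ) : EuclideanSpace ℝ (Fin 3))⟫ = U (-1) 0 2 := by
      simp [EuclideanSpace.inner_single_right]
    have hle := abs_real_inner_le_norm (U (-1) 0) (EuclideanSpace.single 2 (1 : ℝ) : EuclideanSpace ℝ (Fin 3))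
    have hn : ‖(EuclideanSpace.single 2 (1 : ℝ) : EuclideanSpace ℝ (Fin 3))‖ = 1 := by simp
    rw [hi, hn, mul_one] at hle
    exact hle
  linarith

/-- **H2 from the class quadruple** (`isTypeIAncientMild_of_class`). -/
theorem eternalCore_of_hotValue_class {C : ℝ} {U : ℝ → EuclideanSpace ℝ (Fin 3) → EuclideanSpace ℝ (Fin 3)}
    (hrate : HasTypeITimeDecay C U) (hcont : ContinuousOn (uncurry U) (Iio (0 : ℝ) ×ˢ univ))
    (hmild : ∀ s t : ℝ, s < t → t < 0 → ∀ x, U t x = heatExtension (U s) (t - s) x - oseenDuhamel 1 s U U t x)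
    (hdiv : ∀ t < 0, VectorCalculus.IsDivFree (U t)) (hne : U (-1) 0 2 ≠ 0) :
    ∃ ε₀ R₀ : ℝ, 0 < ε₀ ∧ 0 < R₀ ∧ ∀ t₀ : ℝ, t₀ < (-1) → ∃ r ∈ Set.Icc (4 * t₀) t₀, ∃ y : EuclideanSpace ℝ (Fin 3),
      ‖y‖ ≤ R₀ * Real.sqrt (-r) ∧ ε₀ ≤ Real.sqrt (-r) * ‖U r y‖ :=
  eternalCore_of_hotValue (isTypeIAncientMild_of_class hrate hcont hmild hdiv) hne

/-! ### H5a: the (TH) bilinear identity is scale-invariant -/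

/-- ★ **H5a — THE (TH) BILINEAR IDENTITY IS INVARIANT UNDER `nsRescale λ`, `λ > 0`.** -/
theorem bilinearTH_nsRescale {U : ℝ → EuclideanSpace ℝ (Fin 3) → EuclideanSpace ℝ (Fin 3)}
    (hbil : ∀ t < 0, ∀ x x' : EuclideanSpace ℝ (Fin 3), x 2 = x' 2 → ∀ b c : Fin 3, b ≠ 2 → c ≠ 2 →
      fderiv ℝ (U t) x (EuclideanSpace.single 2 1) b * fderiv ℝ (U t) x' (EuclideanSpace.single c 1) 2 =
        fderiv ℝ (U t) x' (EuclideanSpace.single 2 1) c * fderiv ℝ (U t) x (EuclideanSpace.single b 1) 2)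
    {lam : ℝ} (hlam : 0 < lam) :
    ∀ t < 0, ∀ x x' : EuclideanSpace ℝ (Fin 3), x 2 = x' 2 → ∀ b c : Fin 3, b ≠ 2 → c ≠ 2 →
      fderiv ℝ (nsRescale lam U t) x (EuclideanSpace.single 2 1) b * fderiv ℝ (nsRescale lam U t) x' (EuclideanSpace.single c 1) 2 =
        fderiv ℝ (nsRescale lam U t) x' (EuclideanSpace.single 2 1) c * fderiv ℝ (nsRescale lam U t) x (EuclideanSpace.single b 1) 2 := by
  intro t ht x x' hxx' b c hb hc
  have hst : lam ^ 2 * t < 0 := mul_neg_of_pos_of_neg (pow_pos hlam 2) ht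
  have hxx'' : (lam • x : EuclideanSpace ℝ (Fin 3)) 2 = (lam • x' : EuclideanSpace ℝ (Fin 3)) 2 := by simp [hxx']
  have h := hbil (lam ^ 2 * t) hst (lam • x) (lam • x') hxx'' b c hb hc
  have happ : ∀ (y v : EuclideanSpace ℝ (Fin 3)) (i : Fin 3),
      fderiv ℝ (nsRescale lam U t) y v i = lam ^ 2 * fderiv ℝ (U (lam ^ 2 * t)) (lam • y) v i := by
    intro y v i
    rw [fderiv_nsRescale_slice]
    rfl
  simp only [happ]
  linear_combination (lam ^ 2) * (lam ^ 2) * h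

/-! ### H5b: the (TH) bilinear identity passes to limits -/

/-- ★ **H5b — THE (TH) BILINEAR IDENTITY PASSES TO LIMITS** under pointwise convergence of the first derivatives. -/
theorem bilinearTH_of_tendsto_fderiv {Ws : ℕ → ℝ → EuclideanSpace ℝ (Fin 3) → EuclideanSpace ℝ (Fin 3)} {W : ℝ → EuclideanSpace ℝ (Fin 3) → EuclideanSpace ℝ (Fin 3)}
    (hconv : ∀ t < 0, ∀ x : EuclideanSpace ℝ (Fin 3), Tendsto (fun j => fderiv ℝ (Ws j t) x) atTop (𝓝 (fderiv ℝ (W t) x)))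
    (hbil : ∀ j : ℕ, ∀ t < 0, ∀ x x' : EuclideanSpace ℝ (Fin 3), x 2 = x' 2 → ∀ b c : Fin 3, b ≠ 2 → c ≠ 2 →
      fderiv ℝ (Ws j t) x (EuclideanSpace.single 2 1) b * fderiv ℝ (Ws j t) x' (EuclideanSpace.single c 1) 2 =
        fderiv ℝ (Ws j t) x' (EuclideanSpace.single 2 1) c * fderiv ℝ (Ws j t) x (EuclideanSpace.single b 1) 2) :
    ∀ t < 0, ∀ x x' : EuclideanSpace ℝ (Fin 3), x 2 = x' 2 → ∀ b c : Fin 3, b ≠ 2 → c ≠ 2 →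
      fderiv ℝ (W t) x (EuclideanSpace.single 2 1) b * fderiv ℝ (W t) x' (EuclideanSpace.single c 1) 2 =
        fderiv ℝ (W t) x' (EuclideanSpace.single 2 1) c * fderiv ℝ (W t) x (EuclideanSpace.single b 1) 2 := by
  intro t ht x x' hxx' b c hb hc
  -- evaluation at a vector and a coordinate is continuous on the space of linear maps
  have hev : ∀ (y v : EuclideanSpace ℝ (Fin 3)) (i : Fin 3),
      Tendsto (fun j => fderiv ℝ (Ws j t) y v i) atTop (𝓝 (fderiv ℝ (W t) y v i)) := by
    intro y v i
    have h1 : Tendsto (fun j => fderiv ℝ (Ws j t) y v) atTop (𝓝 (fderiv ℝ (W t) y v)) :=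
      ((ContinuousLinearMap.apply ℝ (EuclideanSpace ℝ (Fin 3)) v).continuous.tendsto _).comp (hconv t ht y)
    exact ((EuclideanSpace.proj (𝕜 := ℝ) i).continuous.tendsto _).comp h1
  have hL : Tendsto (fun j => fderiv ℝ (Ws j t) x (EuclideanSpace.single 2 1) b * fderiv ℝ (Ws j t) x' (EuclideanSpace.single c 1) 2) atTop
      (𝓝 (fderiv ℝ (W t) x (EuclideanSpace.single 2 1) b * fderiv ℝ (W t) x' (EuclideanSpace.single c 1) 2)) :=
    (hev x _ b).mul (hev x' _ 2)
  have hR : Tendsto (fun j => fderiv ℝ (Ws j t) x' (EuclideanSpace.single 2 1) c * fderiv ℝ (Ws j t) x (EuclideanSpace.single b 1) 2) atTop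
      (𝓝 (fderiv ℝ (W t) x' (EuclideanSpace.single 2 1) c * fderiv ℝ (W t) x (EuclideanSpace.single b 1) 2)) :=
    (hev x' _ c).mul (hev x _ 2)
  have heq : (fun j => fderiv ℝ (Ws j t) x (EuclideanSpace.single 2 1) b * fderiv ℝ (Ws j t) x' (EuclideanSpace.single c 1) 2) =
      fun j => fderiv ℝ (Ws j t) x' (EuclideanSpace.single 2 1) c * fderiv ℝ (Ws j t) x (EuclideanSpace.single b 1) 2 :=
    funext fun j => hbil j t ht x x' hxx' b c hb hc
  rw [heq] at hL
  exact tendsto_nhds_unique hL hR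

/-! ### H3: identification of the limit -/

/-- **H3 glue — a pointwise limit along a subsequence of a locally uniformly convergent sequence is the locally uniform limit.** -/
theorem eq_of_tendstoLocallyUniformly_subseq {F : ℕ → EuclideanSpace ℝ (Fin 3) → EuclideanSpace ℝ (Fin 3)} {f : EuclideanSpace ℝ (Fin 3) → EuclideanSpace ℝ (Fin 3)}
    (hF : TendstoLocallyUniformly F f atTop) {φ : ℕ → ℕ} (hφ : StrictMono φ) {x y : EuclideanSpace ℝ (Fin 3)}
    (hy : Tendsto (fun j => F (φ j) x) atTop (𝓝 y)) : y = f x := by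
  have h1 : Tendsto (fun n => F n x) atTop (𝓝 (f x)) := by
    have h := hF.tendstoLocallyUniformlyOn (s := univ)
    exact h.tendsto_at (mem_univ x)
  have h2 : Tendsto (fun j => F (φ j) x) atTop (𝓝 (f x)) := h1.comp hφ.tendsto_atTop
  exact tendsto_nhds_unique hy h2

end Summit.NavierStokesRegularity.NavierStokesRegularity.Theorems.PoloidalWindowDoorLrcModEntireQ4CurvedFlatLimitEntrance

end
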